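import Summits.AtomisticToContinuum.HydrodynamicLimit.Theorems.RelayRaceLocalityNearConstantShortTimeHLExpCapDefs
import Summits.AtomisticToContinuum.HydrodynamicLimit.Theorems.RelayRaceLocalityNearConstantShortTimeHLGoodEvents
import HarnessLib

/-!
# Crux `NearConstantShortTimeHL` (stmt-AtomisticToContinuum-12502), line `small-tilt-domination` — CLOSURE INPUTS ALONG THE TRUE LAW instead of
# imported equilibrium K-stubs: the typed inputs S2ᵀ/S3ᵀ `TrueLawMomentumClosure` / `TrueLawEnergyClosure` and the dynamic theorem
# `DynamicTheoremTL` (typed statements, lead c10, skeleton v25)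

Reviewed Defs file of the line (lead prover-line-stmt-AtomisticToContinuum-12502-c10-0). WHY: skeletons v13–v24 typed the closure inputs of Yau's
relative-entropy Grönwall as EQUILIBRIUM dynamical large-deviation bounds under the invariant drifted Gibbs law `G_N` ("K-stubs", last form
`MomentumClosureTightnessPX` / `EnergyClosureTightnessPX`, `…ExpCapDefs`) imported along the true law `P_N` through the pointwise tilt domination
`P_N ≤ e^{Cδ₀ n} G_N` (`TiltDomination`, `eventImport_of_tiltDomination`). The import closes only if the equilibrium rate beats `Cδ₀`; the
Grönwall needs the defect threshold `δ → 0` along the diagonal grid (`good_event_packagePX`: threshold `(i+1)⁻²`, windows `t/i`) while `δ₀` is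
fixed by the data, so the rate `c₀(M)` had to be UNIFORM in `δ` (chosen before `δ, τ, K`; `δ₀ := c₀/(8CK)` in `…ReductionPX`). A `δ`-uniform rate
is a SUPER-EXPONENTIAL closure estimate (the one-block lemma of stochastic lattice gases, Kipnis–Landim Ch. 5, where noise supplies it); for
deterministic hard spheres the energy row was priced physics-false under every admissible velocity cap by leads c7/c9 (needle beams, giant-driver
Newton cradles, log-speed train cradles: coherent microstructures of Gibbs cost `∝ (energy moved)/θ ∝ δ n`, evidence #65/#68 on the item,
`Cruxes/NearConstantShortTimeHL/Lines/small-tilt-domination-S3PQ-stub-false.md`, `…-S3PX-stub-false.md`). Skeleton v25 therefore DROPS THE IMPORT and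
types the two closure inputs ALONG THE TRUE LAW, as convergence in probability — no rate, no uniformity: this is the one-block /
local-equilibrium input of [Yau1991, §2], [OllaVaradhanYau1993, §1, §4], [KipnisLandim1999, Ch. 6 §1] (a theorem there thanks to the noise; for
deterministic hard spheres the named open "derivation of local equilibrium", [Spohn1991, Part I §2.3–2.4]). The statements below are WEAKER than the
v24 residue (for near-constant data `MomentumClosureTightnessPX ∧ TiltDomination` give `P_N(E) ≤ e^{(Cδ₀−c₀)n} → 0`, i.e. S2ᵀ; likewise S3ᵀ),
they are not hit by any priced family (all exponentially rare along the true law), and they are not the crux restated: they concern the windowed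
FLUX functionals (`momDefect`, `enDefect`: velocity third moments and the collisional virial against the Euler fluxes of the ball averages), while
the conserved fields following THE classical solution needs in addition the weak–strong stability supplied by the landed Grönwall and the caps
`TrueLawCapsPE`. Near-constancy of the data becomes idle in v25 (Yau's method needs none); the crux keeps it.

* S2ᵀ `TrueLawMomentumClosure` / S3ᵀ `TrueLawEnergyClosure`: same binder as `TrueLawCapsPE` (`…ExpTailDefs`: profiles, `σ < σ₀(profile)`, general
  families, a classical solution tied at `t = 0` by the LLN, `t` before its horizon, packing band `ρσ³ ≤ η₁/2` on `[0,t]`), then: for every window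
  `[s, s+τ] ⊆ [0, t]`, every normalised smooth test, every `δ > 0` and cap level `K > 0`,
  `P_N {packing cap η₁ ∧ integrated exponential cap K on the window ∧ δ < |windowed weak-form closure defect|} → 0`.
* `DynamicTheoremTL`: verbatim `DynamicTheoremPX` with the reference laws `G`, the rates `aI < c₀`, the import `hImp` DELETED and the two
  equilibrium closure bounds `hKmom` / `hKen` REPLACED by the true-law hypotheses `hPmom` / `hPen` (Tendsto form, windows `s + τ ≤ t`). Proof (file
  `…DynamicTL`): the landed `stub_dynamicPX` over `good_event_packageTL` (the PX package with the diagonal extraction fed by `P`-smallness,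
  `exists_goodEvents_of_tendsto` below, instead of import + rate gap).

Contents: `TrueLawMomentumClosure` (S2ᵀ), `TrueLawEnergyClosure` (S3ᵀ), `DynamicTheoremTL` (statements, no mathematics); PROVED:
`exists_goodEvents_of_tendsto` (the generic good-event extraction from `P`-smallness — `exists_goodEvents_of_importI` with the import and the rate gap
replaced by `P N (E i q N) → 0` for each fixed grid index; the diagonal runs through `exists_diagonal_index` as before) and `tendsto_zero_of_import`
(import + `G`-exponential smallness with a rate gap ⇒ `P`-smallness: the v24 hypotheses imply the v25 ones event by event).
References: H.-T. Yau, Lett. Math. Phys. 22 (1991) §2; S. Olla – S.R.S. Varadhan – H.-T. Yau, Comm. Math. Phys. 155 (1993) §1, §4; C. Kipnis –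
C. Landim, Scaling Limits of Interacting Particle Systems (1999) Ch. 5–6; H. Spohn, Large Scale Dynamics of Interacting Particles (1991) Part I §2.3–2.4.
-/

noncomputable section

namespace Summit.AtomisticToContinuum.HydrodynamicLimit.Theorems.NearConstantShortTimeHL

open scoped BigOperators ENNReal
open MeasureTheory Set Filter Topology
open Literature.MathematicalPhysics.KineticTheory Literature.Analysis.FluidPDE Literature.Analysis.FunctionSpaces

/-- **S2ᵀ — MOMENTUM CLOSURE IN PROBABILITY ALONG THE TRUE LAW** (input of skeleton v25; OPEN, delegated-grade: the one-block / local-equilibrium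
statement for the momentum flux of deterministic hard spheres). From local-Gibbs data `(a₀, u₀, θ₀)` tied at `t = 0` to a classical hs-Euler solution
by the LLN, for `t` before the solution's horizon and inside the packing band `ρσ³ ≤ η₁/2`: for every window `[s, s+τ] ⊆ [0, t]`, every normalised
smooth vector test `ψ`, every `δ > 0` and every cap level `K`, the true-law probability that the orbit keeps the ball-packing cap `η₁` and the integrated
exponential cap `K` on the window AND has windowed weak-form momentum closure defect `> δ` tends to `0`. No rate and no uniformity in `δ` (contrast
S2⁵ `MomentumClosureTightnessPX`); implied by S2⁵ + `TiltDomination` for near-constant data. [cite: Yau1991, §2] [cite: OllaVaradhanYau1993, §1] -/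
@[conjecture] def TrueLawMomentumClosure : Prop :=
  ∃ η₁ : ℝ, 0 < η₁ ∧ ∀ (a₀ θ₀ : T3 → ℝ) (u₀ : T3 → V3), Continuous a₀ → Continuous θ₀ → Continuous u₀ →
    (∀ x, 0 < a₀ x) → (∀ x, 0 < θ₀ x) → ∃ σ₀ : ℝ, 0 < σ₀ ∧ ∀ σ : ℝ, 0 < σ → σ < σ₀ →
    ∀ (ε : ℕ → ℝ) (n : ℕ → ℕ), (∀ N, 0 < ε N) → Tendsto ε atTop (nhds 0) →
    Tendsto (fun N => (n N : ℝ) * ε N ^ 3) atTop (nhds (σ ^ 3)) →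
    ∀ (T : ℝ) (ρ θ : ℝ → T3 → ℝ) (u : ℝ → T3 → V3), IsHardSphereEulerSolution σ T ρ u θ →
    ∀ Φ : (N : ℕ) → HardSphereFlow (Torus.geometry (Fin 3)) (ε N) (n N),
    let P : (N : ℕ) → Measure (Config (n N) (Fin 3) T3) := fun N =>
      particleLaw (Φ N) (canonicalDensity (Torus.geometry (Fin 3)) (ε N) (n N) (localGibbsProfile a₀ u₀ θ₀));
    (∀ N, IsProbabilityMeasure (P N)) →
    (∀ χ : T3 → ℝ, Continuous χ → ∀ δ : ℝ, 0 < δ →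
      Tendsto (fun N => P N {z | δ < |empiricalDensityField ((Φ N).flow 0 z) χ - ∫ x, χ x * ρ 0 x|}) atTop (nhds 0) ∧
      Tendsto (fun N => P N {z | δ < ‖empiricalMomentumField ((Φ N).flow 0 z) χ - ∫ x, (χ x * ρ 0 x) • u 0 x‖}) atTop (nhds 0) ∧
      Tendsto (fun N => P N {z | δ < |empiricalEnergyField ((Φ N).flow 0 z) χ -
        ∫ x, χ x * totalEnergyDensity (ρ 0 x) (u 0 x) (θ 0 x)|}) atTop (nhds 0)) →
    ∀ t ∈ Set.Ico 0 T, (∀ s ∈ Set.Icc 0 t, ∀ x, ρ s x * σ ^ 3 ≤ η₁ / 2) →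
    ∀ (s τ : ℝ), 0 ≤ s → 0 < τ → s + τ ≤ t →
    ∀ ψ : ℝ → T3 → V3, Torus.IsSmoothSpaceTimeOn (Set.Icc s (s + τ)) ψ →
    (∀ r ∈ Set.Icc s (s + τ), ∀ x, ‖ψ r x‖ ≤ 1 ∧ ‖Torus.timeDerivWithin (Set.Icc s (s + τ)) ψ r x‖ ≤ 1 ∧
      ∀ i, ‖Torus.partialDeriv i (ψ r) x‖ ≤ 1) →
    ∀ δ : ℝ, 0 < δ → ∀ K : ℝ, 0 < K →
      Tendsto (fun N => P N {z | packCapOn (Φ N) z (Set.Icc s (s + τ)) (mesoRadius (n N)) σ η₁ ∧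
        intExpCapOn (Φ N) z (Set.Icc s (s + τ)) K ∧
        δ < |momDefect σ (Φ N) z (mesoRadius (n N)) s τ ψ|}) atTop (nhds 0)

/-- **S3ᵀ — ENERGY CLOSURE IN PROBABILITY ALONG THE TRUE LAW** (the energy twin of S2ᵀ: scalar tests `φ`, the windowed weak-form ENERGY closure
defect `enDefect`; OPEN, delegated-grade). The coherent energy waveguides that kill every equilibrium energy K-stub at a `δ`-uniform rate (needle beams,
Newton cradles, train cradles: Gibbs cost `∝ δ n`) are exponentially rare along the true law and do not touch this statement; what it asserts is
local equilibrium of the energy flux (third velocity moments + collisional transfer) in the typical sense. [cite: Yau1991, §2] [cite: OllaVaradhanYau1993, §1] -/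
@[conjecture] def TrueLawEnergyClosure : Prop :=
  ∃ η₁ : ℝ, 0 < η₁ ∧ ∀ (a₀ θ₀ : T3 → ℝ) (u₀ : T3 → V3), Continuous a₀ → Continuous θ₀ → Continuous u₀ →
    (∀ x, 0 < a₀ x) → (∀ x, 0 < θ₀ x) → ∃ σ₀ : ℝ, 0 < σ₀ ∧ ∀ σ : ℝ, 0 < σ → σ < σ₀ →
    ∀ (ε : ℕ → ℝ) (n : ℕ → ℕ), (∀ N, 0 < ε N) → Tendsto ε atTop (nhds 0) →
    Tendsto (fun N => (n N : ℝ) * ε N ^ 3) atTop (nhds (σ ^ 3)) →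
    ∀ (T : ℝ) (ρ θ : ℝ → T3 → ℝ) (u : ℝ → T3 → V3), IsHardSphereEulerSolution σ T ρ u θ →
    ∀ Φ : (N : ℕ) → HardSphereFlow (Torus.geometry (Fin 3)) (ε N) (n N),
    let P : (N : ℕ) → Measure (Config (n N) (Fin 3) T3) := fun N =>
      particleLaw (Φ N) (canonicalDensity (Torus.geometry (Fin 3)) (ε N) (n N) (localGibbsProfile a₀ u₀ θ₀));
    (∀ N, IsProbabilityMeasure (P N)) →
    (∀ χ : T3 → ℝ, Continuous χ → ∀ δ : ℝ, 0 < δ →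
      Tendsto (fun N => P N {z | δ < |empiricalDensityField ((Φ N).flow 0 z) χ - ∫ x, χ x * ρ 0 x|}) atTop (nhds 0) ∧
      Tendsto (fun N => P N {z | δ < ‖empiricalMomentumField ((Φ N).flow 0 z) χ - ∫ x, (χ x * ρ 0 x) • u 0 x‖}) atTop (nhds 0) ∧
      Tendsto (fun N => P N {z | δ < |empiricalEnergyField ((Φ N).flow 0 z) χ -
        ∫ x, χ x * totalEnergyDensity (ρ 0 x) (u 0 x) (θ 0 x)|}) atTop (nhds 0)) →
    ∀ t ∈ Set.Ico 0 T, (∀ s ∈ Set.Icc 0 t, ∀ x, ρ s x * σ ^ 3 ≤ η₁ / 2) →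
    ∀ (s τ : ℝ), 0 ≤ s → 0 < τ → s + τ ≤ t →
    ∀ φ : ℝ → T3 → ℝ, Torus.IsSmoothSpaceTimeOn (Set.Icc s (s + τ)) φ →
    (∀ r ∈ Set.Icc s (s + τ), ∀ x, |φ r x| ≤ 1 ∧ |Torus.timeDerivWithin (Set.Icc s (s + τ)) φ r x| ≤ 1 ∧
      ∀ i, |Torus.partialDeriv i (φ r) x| ≤ 1) →
    ∀ δ : ℝ, 0 < δ → ∀ K : ℝ, 0 < K →
      Tendsto (fun N => P N {z | packCapOn (Φ N) z (Set.Icc s (s + τ)) (mesoRadius (n N)) σ η₁ ∧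
        intExpCapOn (Φ N) z (Set.Icc s (s + τ)) K ∧
        δ < |enDefect σ (Φ N) z (mesoRadius (n N)) s τ φ|}) atTop (nhds 0)

/-- **THE DYNAMIC THEOREM AT FIXED DATA, TRUE-LAW CLOSURE INPUTS** (level 1 of the Grönwall assembly of skeleton v25): verbatim `DynamicTheoremPX`
(`…ExpCapDefs`) with the reference laws `G`, the rates `aI < c₀` and the event import `hImp` DELETED, and the equilibrium closure bounds `hKmom` /
`hKen` REPLACED by the true-law closure hypotheses `hPmom` / `hPen`: for every cap level `K`, window `[s, s+τ] ⊆ [0, t]`, normalised smooth test and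
`δ > 0`, `P N {packing cap ∧ integrated exponential cap ∧ δ < |defect|} → 0`. Same conclusion. Proof (file `…DynamicTL`): the landed proof of
`stub_dynamicPX` over `good_event_packageTL`. [cite: Yau1991, §2] -/
@[conjecture] def DynamicTheoremTL : Prop :=
    ∀ {η₀ : ℝ} {F : ℝ → ℝ} (hη₀ : 0 < η₀) (hFa : AnalyticOnNhd ℝ F (Set.Ioo (-η₀) η₀))
    (hEq : Set.EqOn hsExcessFreeEnergy F (Set.Ico 0 η₀))
    {σ T : ℝ} (hσ : 0 < σ) {ρ θ : ℝ → T3 → ℝ} {u : ℝ → T3 → V3} (hE : IsHardSphereEulerSolution σ T ρ u θ)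
    {t : ℝ} (ht : t ∈ Set.Ico 0 T) (ht1 : t < 1) (hband : ∀ s ∈ Set.Icc 0 t, ∀ x, ρ s x * σ ^ 3 < η₀)
    (hmass : ∫ x, ρ 0 x = 1)
    {ηP : ℝ} (hηP : 0 < ηP) (hηP₀ : ηP < η₀)
    {ε : ℕ → ℝ} {n : ℕ → ℕ} (hn : Tendsto n atTop atTop) (hε : ∀ N, 0 < ε N)
    (Φ : (N : ℕ) → HardSphereFlow (Torus.geometry (Fin 3)) (ε N) (n N))
    (P : (N : ℕ) → Measure (Config (n N) (Fin 3) T3))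
    (hPdef : ∀ N, P N = particleLaw (Φ N) (canonicalDensity (Torus.geometry (Fin 3)) (ε N) (n N)
    (localGibbsProfile (fun x => ρ 0 x * Real.exp (gChem σ (ρ 0 x))) (u 0) (θ 0))))
    (hP : ∀ N, IsProbabilityMeasure (P N))
    {π₀ : ℝ} {πst : ℝ → ℝ}
    (hπ₀ : Tendsto (fun N => (n N : ℝ)⁻¹ * Real.log (canonicalPartition (Torus.geometry (Fin 3)) (ε N) (n N)
    (localGibbsProfile (fun x => ρ 0 x * Real.exp (gChem σ (ρ 0 x))) (u 0) (θ 0)))) atTop (nhds π₀))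
    (hπ : TendstoUniformlyOn (fun N r => (n N : ℝ)⁻¹ * Real.log (canonicalPartition (Torus.geometry (Fin 3)) (ε N) (n N)
    (localGibbsProfile (fun x => ρ r x * Real.exp (gChem σ (ρ r x))) (u r) (θ r)))) πst atTop (Set.Icc 0 t))
    (hm₀ : Tendsto (fun N => ∫ z, logProfileObs σ ρ θ u 0 z ∂(P N)) atTop
    (nhds (∫ x, ρ 0 x * (Real.log (ρ 0 x) + gChem σ (ρ 0 x) - 3 / 2 * Real.log (2 * Real.pi * θ 0 x) - 3 / 2))))
    (hm₀i : ∀ᶠ N : ℕ in atTop, Integrable (fun z => logProfileObs σ ρ θ u 0 z) (P N))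
    (hiso : ∀ r ∈ Set.Icc 0 t,
    (∫ x, ρ 0 x * (Real.log (ρ 0 x) + gChem σ (ρ 0 x) - 3 / 2 * Real.log (2 * Real.pi * θ 0 x) - 3 / 2)) - π₀ =
    (∫ x, ρ r x * (Real.log (ρ r x) + gChem σ (ρ r x) - 3 / 2 * Real.log (2 * Real.pi * θ r x) - 3 / 2)) - πst r)
    {γ : ℝ} (hγ : 0 < γ)
    (hSt2 : ∀ κ : ℝ, 0 < κ → ∀ᶠ N : ℕ in atTop, ∀ r ∈ Set.Icc 0 t,
    ∫⁻ w, ENNReal.ofReal (Real.exp (γ * (n N : ℝ) * fluctuationE (mesoRadius (n N)) (ρ r) (θ r) (u r) w))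
    ∂(particleLaw (Φ N) (canonicalDensity (Torus.geometry (Fin 3)) (ε N) (n N)
    (localGibbsProfile (fun x => ρ r x * Real.exp (gChem σ (ρ r x))) (u r) (θ r)))) ≤
    ENNReal.ofReal (Real.exp (κ * (n N : ℝ))))
    (hcapP : Tendsto (fun N => P N {z | ∃ r ∈ Set.Icc 0 t, ∃ x : T3,
    ηP < empiricalDensityField ((Φ N).flow r z) (ballKernel (mesoRadius (n N)) x) * σ ^ 3}) atTop (nhds 0))
    {C₄ : ℝ} (hC₄ : 0 ≤ C₄)
    (hcapX : ∀ K : ℝ, 0 < K → ∀ᶠ N : ℕ in atTop, P N {z | ENNReal.ofReal K <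
      ∫⁻ r in Set.Icc 0 t, ENNReal.ofReal ((n N : ℝ)⁻¹ * ∑ i : Fin (n N), Real.exp ‖((Φ N).flow r z i).2‖)} ≤
      ENNReal.ofReal (C₄ / K))
    (hexpm : ∀ b : ℝ, 0 < b → ∃ A : ℝ, 0 ≤ A ∧ ∀ᶠ N : ℕ in atTop, ∀ s ∈ Set.Icc 0 t,
    ∫⁻ z, ENNReal.ofReal ((n N : ℝ)⁻¹ * ∑ i : Fin (n N), Real.exp (b * ‖((Φ N).flow s z i).2‖)) ∂(P N) ≤
    ENNReal.ofReal A)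
    {η₂ η₃ : ℝ} (hη₂ : ηP ≤ η₂) (hη₃ : ηP ≤ η₃)
    (hPmom : ∀ K : ℝ, 0 < K → ∀ (s τ : ℝ), 0 ≤ s → 0 < τ → s + τ ≤ t →
    ∀ ψ : ℝ → T3 → V3, Torus.IsSmoothSpaceTimeOn (Set.Icc s (s + τ)) ψ →
    (∀ r ∈ Set.Icc s (s + τ), ∀ x, ‖ψ r x‖ ≤ 1 ∧ ‖Torus.timeDerivWithin (Set.Icc s (s + τ)) ψ r x‖ ≤ 1 ∧
    ∀ i, ‖Torus.partialDeriv i (ψ r) x‖ ≤ 1) →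
    ∀ δ : ℝ, 0 < δ → Tendsto (fun N =>
    P N {z | packCapOn (Φ N) z (Set.Icc s (s + τ)) (mesoRadius (n N)) σ η₂ ∧
    intExpCapOn (Φ N) z (Set.Icc s (s + τ)) K ∧
    δ < |momDefect σ (Φ N) z (mesoRadius (n N)) s τ ψ|}) atTop (nhds 0))
    (hPen : ∀ K : ℝ, 0 < K → ∀ (s τ : ℝ), 0 ≤ s → 0 < τ → s + τ ≤ t →
    ∀ φ : ℝ → T3 → ℝ, Torus.IsSmoothSpaceTimeOn (Set.Icc s (s + τ)) φ →
    (∀ r ∈ Set.Icc s (s + τ), ∀ x, |φ r x| ≤ 1 ∧ |Torus.timeDerivWithin (Set.Icc s (s + τ)) φ r x| ≤ 1 ∧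
    ∀ i, |Torus.partialDeriv i (φ r) x| ≤ 1) →
    ∀ δ : ℝ, 0 < δ → Tendsto (fun N =>
    P N {z | packCapOn (Φ N) z (Set.Icc s (s + τ)) (mesoRadius (n N)) σ η₃ ∧
    intExpCapOn (Φ N) z (Set.Icc s (s + τ)) K ∧
    δ < |enDefect σ (Φ N) z (mesoRadius (n N)) s τ φ|}) atTop (nhds 0)),
    ∀ κ : ℝ, 0 < κ → ∀ᶠ N in atTop,
    Integrable (fun z => logProfileObs σ ρ θ u t ((Φ N).flow t z)) (P N) ∧
    (∫ x, ρ t x * (Real.log (ρ t x) + gChem σ (ρ t x) - 3 / 2 * Real.log (2 * Real.pi * θ t x) - 3 / 2)) - κ ≤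
    ∫ z, logProfileObs σ ρ θ u t ((Φ N).flow t z) ∂(P N)


/-! ## The good-event extraction from `P`-smallness (v25) and its relation to the v24 import -/

/-- Arithmetic of the diagonal budget: `Q · (1/((i+1)(Q+1))) ≤ 1/(i+1)`. [folklore] -/
theorem xg_count_mul_budget_le (i Q : ℕ) :
    (Q : ℝ) * (1 / (((i : ℝ) + 1) * ((Q : ℝ) + 1))) ≤ 1 / ((i : ℝ) + 1) := by
  have hi : (0 : ℝ) < (i : ℝ) + 1 := by positivity
  have hQ : (0 : ℝ) < (Q : ℝ) + 1 := by positivity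
  rw [mul_one_div, div_le_div_iff₀ (mul_pos hi hQ) hi]
  nlinarith [Nat.cast_nonneg (α := ℝ) Q]

/-- **Good-event extraction from `P`-smallness, indexed bad sets** (the v25 replacement of `exists_goodEvents_of_importI`: no reference law, no
import, no rate). If for each fixed grid index `i` each of the `Q i` defect events has `P N (E i q N) → 0`, side conditions `p i N` hold eventually
for each fixed `i`, and indexed cap failures satisfy `P N (B i N) ≤ b i` eventually with `b i → 0`, then there are a diagonal index `ι(N) → ∞` with
`p (ι N) N` eventually and measurable good events `G' N` with `P N (G' N)ᶜ → 0`, eventually avoiding `B (ι N) N` and every `E (ι N) q N`,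
`q < Q (ι N)`. The bad set has `P`-mass `≤ b (ι N) + Q (ι N)/((ι N + 1)(Q (ι N) + 1)) ≤ b (ι N) + 1/(ι N + 1) → 0`. [folklore] -/
theorem exists_goodEvents_of_tendsto : ∀ {Ω : ℕ → Type*} [∀ N, MeasurableSpace (Ω N)]
    (P : (N : ℕ) → MeasureTheory.Measure (Ω N)) (Q : ℕ → ℕ) (E : (i q N : ℕ) → Set (Ω N)),
    (∀ i, ∀ q < Q i, Filter.Tendsto (fun N => P N (E i q N)) Filter.atTop (nhds 0)) →
    ∀ (p : ℕ → ℕ → Prop), (∀ i, ∀ᶠ N in Filter.atTop, p i N) →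
    ∀ (B : (i N : ℕ) → Set (Ω N)) (b : ℕ → ENNReal), Filter.Tendsto b Filter.atTop (nhds 0) →
    (∀ i, ∀ᶠ N in Filter.atTop, P N (B i N) ≤ b i) →
    ∃ ι : ℕ → ℕ, Filter.Tendsto ι Filter.atTop Filter.atTop ∧ (∀ᶠ N in Filter.atTop, p (ι N) N) ∧
      ∃ G' : (N : ℕ) → Set (Ω N), (∀ N, MeasurableSet (G' N)) ∧
        Filter.Tendsto (fun N => P N (G' N)ᶜ) Filter.atTop (nhds 0) ∧
        ∀ᶠ N in Filter.atTop, G' N ⊆ (B (ι N) N)ᶜ ∧ ∀ q < Q (ι N), G' N ⊆ (E (ι N) q N)ᶜ := by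
  intro Ω _ P Q E hE p hp B b hb hPB
  -- (1) the combined eventual property for each FIXED index `i` (side condition, cap failure, defects below the budget)
  have hcomb : ∀ i, ∀ᶠ N in atTop, p i N ∧ P N (B i N) ≤ b i ∧
      ∀ q ∈ Finset.range (Q i), P N (E i q N) ≤ ENNReal.ofReal (1 / (((i : ℝ) + 1) * ((Q i : ℝ) + 1))) := by
    intro i
    refine (hp i).and ((hPB i).and ((Finset.range (Q i)).eventually_all.2 fun q hq => ?_))
    have hpos : (0 : ℝ≥0∞) < ENNReal.ofReal (1 / (((i : ℝ) + 1) * ((Q i : ℝ) + 1))) :=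
      ENNReal.ofReal_pos.2 (by positivity)
    exact ((tendsto_order.1 (hE i q (Finset.mem_range.1 hq))).2 _ hpos).mono fun N hN => hN.le
  -- (2) the diagonal index
  obtain ⟨ι, hι, hιp⟩ := exists_diagonal_index hcomb
  -- (3) bad sets and good events
  let B' : (N : ℕ) → Set (Ω N) := fun N => B (ι N) N ∪ ⋃ q ∈ Finset.range (Q (ι N)), E (ι N) q N
  let G' : (N : ℕ) → Set (Ω N) := fun N => (toMeasurable (P N) (B' N))ᶜ
  refine ⟨ι, hι, hιp.mono fun N hN => hN.1, G', fun N => (measurableSet_toMeasurable _ _).compl, ?_, ?_⟩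
  · -- (4)-(5) `P N (G' N)ᶜ = P N (B' N) ≤ b (ι N) + 1/(ι N + 1) → 0`
    have hbound : ∀ᶠ N in atTop, P N (G' N)ᶜ ≤ b (ι N) + ENNReal.ofReal (1 / ((ι N : ℝ) + 1)) := by
      filter_upwards [hιp] with N hN
      obtain ⟨_, hBb, hPE⟩ := hN
      have h1 : P N (G' N)ᶜ = P N (B' N) := by
        show P N (toMeasurable (P N) (B' N))ᶜᶜ = P N (B' N)
        rw [compl_compl, measure_toMeasurable]
      rw [h1]
      calc P N (B' N) ≤ P N (B (ι N) N) + P N (⋃ q ∈ Finset.range (Q (ι N)), E (ι N) q N) :=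
            measure_union_le _ _
        _ ≤ b (ι N) + ∑ q ∈ Finset.range (Q (ι N)), P N (E (ι N) q N) := by
          gcongr
          exact measure_biUnion_finset_le _ _
        _ ≤ b (ι N) + ∑ q ∈ Finset.range (Q (ι N)),
            ENNReal.ofReal (1 / (((ι N : ℝ) + 1) * ((Q (ι N) : ℝ) + 1))) := by
          gcongr with q hq
          exact hPE q hq
        _ = b (ι N) + ENNReal.ofReal ((Q (ι N) : ℝ) * (1 / (((ι N : ℝ) + 1) * ((Q (ι N) : ℝ) + 1)))) := by
          rw [Finset.sum_const, Finset.card_range, nsmul_eq_mul, ENNReal.ofReal_mul (Nat.cast_nonneg _),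
            ENNReal.ofReal_natCast]
        _ ≤ b (ι N) + ENNReal.ofReal (1 / ((ι N : ℝ) + 1)) := by
          gcongr
          exact xg_count_mul_budget_le _ _
    have hlim : Tendsto (fun N => b (ι N) + ENNReal.ofReal (1 / ((ι N : ℝ) + 1))) atTop (nhds 0) := by
      have h1 : Tendsto (fun N => ENNReal.ofReal (1 / ((ι N : ℝ) + 1))) atTop (nhds 0) := by
        have := ENNReal.tendsto_ofReal ((tendsto_one_div_add_atTop_nhds_zero_nat (𝕜 := ℝ)).comp hι)
        simpa using this
      have h2 : Tendsto (fun N => b (ι N)) atTop (nhds 0) := hb.comp hι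
      simpa using h2.add h1
    exact tendsto_of_tendsto_of_tendsto_of_le_of_le' tendsto_const_nhds hlim
      (Eventually.of_forall fun _ => zero_le) hbound
  · -- avoidance (valid for every `N`)
    refine Eventually.of_forall fun N => ?_
    have hsub : G' N ⊆ (B' N)ᶜ := compl_subset_compl.2 (subset_toMeasurable _ _)
    refine ⟨hsub.trans (compl_subset_compl.2 subset_union_left), fun q hq =>
      hsub.trans (compl_subset_compl.2 (subset_union_of_subset_right ?_ _))⟩
    exact Set.subset_iUnion₂ (s := fun q (_ : q ∈ Finset.range (Q (ι N))) => E (ι N) q N) q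
      (Finset.mem_range.2 hq)

/-- **The v24 hypotheses imply the v25 ones, event by event**: under the event import `P N A ≤ e^{a n_N} G N A` along `n_N → ∞`, `G`-exponential
smallness `G N (E N) ≤ e^{-c₀ n_N}` eventually with a rate gap `a < c₀` gives `P N (E N) → 0`. [folklore] -/
theorem tendsto_zero_of_import {Ω : ℕ → Type*} [∀ N, MeasurableSpace (Ω N)]
    (P G : (N : ℕ) → MeasureTheory.Measure (Ω N)) {n : ℕ → ℕ} (hn : Tendsto n atTop atTop) {a c₀ : ℝ} (hac : a < c₀)
    (himp : ∀ N (A : Set (Ω N)), P N A ≤ ENNReal.ofReal (Real.exp (a * n N)) * G N A) (E : (N : ℕ) → Set (Ω N))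
    (hE : ∀ᶠ N in atTop, G N (E N) ≤ ENNReal.ofReal (Real.exp (-(c₀ * n N)))) :
    Tendsto (fun N => P N (E N)) atTop (nhds 0) := by
  have hlim : Tendsto (fun N => ENNReal.ofReal (1 * (Real.exp (a * n N) * Real.exp (-(c₀ * n N))))) atTop (nhds 0) := by
    have := ENNReal.tendsto_ofReal (xg_tendsto_count_mul_exp_zero hn hac 1)
    simpa only [ENNReal.ofReal_zero] using this
  refine tendsto_of_tendsto_of_tendsto_of_le_of_le' tendsto_const_nhds hlim (Eventually.of_forall fun _ => zero_le) ?_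
  filter_upwards [hE] with N hN
  calc P N (E N) ≤ ENNReal.ofReal (Real.exp (a * n N)) * G N (E N) := himp N _
    _ ≤ ENNReal.ofReal (Real.exp (a * n N)) * ENNReal.ofReal (Real.exp (-(c₀ * n N))) := by gcongr
    _ = ENNReal.ofReal (1 * (Real.exp (a * n N) * Real.exp (-(c₀ * n N)))) := by
      rw [one_mul, ENNReal.ofReal_mul (Real.exp_pos _).le]

end Summit.AtomisticToContinuum.HydrodynamicLimit.Theorems.NearConstantShortTimeHL

end
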